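import Summits.QuantumFields.YangMills.Theorems.RecentredCoverTransferCellTranslation
import Summits.QuantumFields.YangMills.Theorems.BalabanLadderInfVolCeilingsDefs
import Summits.QuantumFields.YangMills.Theorems.LangevinControlUVOSLegsFromFemtoAndGapStubAssemblyPlaneExpansion
import HarnessLib

/-!
# PARTIAL centred moments of the action density on a period cell: plane-string expansion, collar and sup bounds
# (kit for glue `CoverRecentringOfRate`, route `RecentredCoverTransfer`, stmt-QuantumFields-23144, LINE g9-C of planner ym-idea-1 g9)

Helper file (`--supports stmt-QuantumFields-23144 --as helper`; width seat `ym-line-sfw-p2-w3` g28 of cell ym-idea-1, free hands).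
Route-independent, definition-free, 0 sorry.  Step (4) of the planner's proof of the glue `OnePointRate → CoverMomentBounds6 →
CoverRecentring` needs, for every PROPER subset `S ⊊ [n]`, the collar bound of the PARTIAL centred cell moment
`W^S_C(x) = ∫ ∏_{i∈S} (d(τ_{xᵢ} Ũ) − m_C) dμ_C` of the action density `d = r.curvature.F` centred at the cell's own mean
`m_C = C.mean d`, in the currency of the crux `CoverMomentBounds6` (plane-resolved string moments `stateMomentStr` of the lifted cell
state `Measure.map C.lift μ_C`).  For ANY period cell `C` of `ℤ⁴`:

* §1 measurability / integrability of plane fields and their centred products through the lift; ★ `integral_plane_cellLift_eq` —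
  the one-point function of every plane field is the constant `C.mean P^q_0` (cell-translation invariance, sibling kit);
* §2 ★ `stateMomentStr_map_cellLift` — the string moments of the lifted cell state are cell integrals (`integral_map`), and
  ★ `mean_curvature_eq_sum_plane` / `dens_cellLift_sub_mean_eq_sum` — `d − m_C = Σ_{q} (P^q − m^q_C)` over the six orientations;
* §3 ★ `partialMoment_eq_sum_stateMomentStr` — `W^S_C(x) = Σ_{q : S → planes} stateMomentStr (map lift μ_C) |S| q x_S` (reindex `S` by
  `Fin |S|`, expand the product of six-term sums), hence ★ `abs_partialMoment_le_of_strings` — a `CoverMomentBounds6`-type ceiling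
  `(C₀/R⁴)^m` for the strings of THIS cell gives `|W^S_C(x)| ≤ (6C₀/R⁴)^|S|` for `x_S ⊆ box(L/2)` pairwise collar-separated;
* §4 ★ `abs_partialMoment_le_pow` — the sup bound `|W^S_C(x)| ≤ (2B)^|S|` (`|d| ≤ B`).

HONEST FRAMING: `OnePointRate` (23142), `CoverMomentBounds6` (23143), `CoverRecentring` (23105) stay OPEN; no item is closed here; no
summit, rung (R2d ROT is a RECORD rung) or mass gap is proved.  References: Glimm–Jaffe (1987) §6.1; E. Seiler, LNP 159 (1982) Ch. 2.
-/

set_option autoImplicit false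

noncomputable section

open scoped SchwartzMap BigOperators ENNReal
open MeasureTheory Filter Topology
open Literature.MathematicalPhysics.QuantumFieldTheory Literature.MathematicalPhysics.QuantumLattice
open Literature.MathematicalPhysics.AQFT
open Literature.Probability.LatticeModels (Site box mem_box)
open Summit.QuantumFields.YangMills.Theorems.ROT (PeriodCell)
open Summit.QuantumFields.YangMills.Cruxes.OSLegsFromFemtoAndGap.DlrCollarTransfer
  (dens plane continuous_plane exists_abs_plane_le)
open Summit.QuantumFields.YangMills.Theorems.OSLegsFromFemtoAndGap (dens_eq_sum_filter_plane card_planes)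
open Summit.QuantumFields.YangMills.Theorems.InfiniteVolume (stateMomentStr)

namespace Summit.QuantumFields.YangMills.Theorems.RecentredCoverTransfer

variable {G : Type} [Group G] [TopologicalSpace G] [IsTopologicalGroup G] [CompactSpace G]
  [MeasurableSpace G] [BorelSpace G] (Ce : PeriodCell 4) (r : LatticeRep G)

/-! ## §1 Plane fields through the cell lift -/

/-- The plane fields are measurable on the infinite-lattice configurations (second countability of `G` from the faithful
representation). [folklore] -/
theorem measurable_plane (q : Fin 4 × Fin 4) (x : Site 4) : Measurable (plane G r q x) := by
  haveI : SecondCountableTopology G :=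
    (r.continuous.isClosedEmbedding r.injective).isEmbedding.secondCountableTopology
  exact (measurable_plaquetteObs r.ρ r.continuous 0 q.1 q.2).comp
    (Literature.MathematicalPhysics.QuantumLattice.configShift _).measurable

/-- Measurability of the plane fields read through the periodic lift of the cell. [folklore] -/
theorem measurable_plane_cellLift (q : Fin 4 × Fin 4) (x : Site 4) :
    Measurable fun U : Ce.Config G => plane G r q x (Ce.lift U) :=
  (measurable_plane r q x).comp (measurable_cellLift Ce)

/-- Products of centred plane fields (read through the lift) are integrable for Wilson's law on the cell. [folklore] -/
theorem integrable_prod_plane_sub_cell (β : ℝ) {n : ℕ} (q : Fin n → Fin 4 × Fin 4) (x : Fin n → Site 4) (c : Fin n → ℝ) :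
    Integrable (fun U : Ce.Config G => ∏ i, (plane G r (q i) (x i) (Ce.lift U) - c i)) (Ce.measure r.ρ β) := by
  haveI := Ce.isProbabilityMeasure_measure r.ρ r.continuous β
  obtain ⟨B, hB⟩ := exists_abs_plane_le (G := G) r
  have hmeas : ∀ i, Measurable fun U : Ce.Config G => plane G r (q i) (x i) (Ce.lift U) - c i := fun i =>
    (measurable_plane_cellLift Ce r (q i) (x i)).sub measurable_const
  refine Integrable.of_bound (Finset.measurable_prod _ fun i _ => hmeas i).aestronglyMeasurable (∏ i, (|B| + |c i|)) ?_
  refine Eventually.of_forall fun U => ?_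
  rw [Real.norm_eq_abs, Finset.abs_prod]
  exact Finset.prod_le_prod (fun _ _ => abs_nonneg _) fun i _ =>
    (abs_sub _ _).trans (add_le_add ((hB _ _ _).trans (le_abs_self B)) le_rfl)

/-- A single plane field through the lift is integrable on the cell. [folklore] -/
theorem integrable_plane_cellLift (β : ℝ) (q : Fin 4 × Fin 4) (x : Site 4) :
    Integrable (fun U : Ce.Config G => plane G r q x (Ce.lift U)) (Ce.measure r.ρ β) := by
  have h := integrable_prod_plane_sub_cell Ce r β (fun _ : Fin 1 => q) (fun _ => x) (fun _ => 0)
  refine h.congr (Eventually.of_forall fun U => ?_)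
  simp

/-- ★ **The one-point function of a plane field on the cell is constant**: `∫ P^q_x(Ũ) dμ_C = C.mean P^q_0` for every site `x`
(cell-translation invariance). [folklore] -/
theorem integral_plane_cellLift_eq (β : ℝ) (q : Fin 4 × Fin 4) (x : Site 4) :
    ∫ U, plane G r q x (Ce.lift U) ∂(Ce.measure r.ρ β) = Ce.mean r.ρ β (fun V => plaquetteObs r.ρ 0 q.1 q.2 V) :=
  integral_obs_shift_lift_eq_mean Ce r.ρ β _ x

/-! ## §2 String moments of the lifted cell state; the density as the sum of the six plane fields -/

/-- ★ **The string moments of the lifted cell state are cell integrals**: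
`stateMomentStr (map lift μ_C) n q x = ∫ ∏ᵢ (P^{qᵢ}_{xᵢ}(Ũ) − C.mean P^{qᵢ}_0) dμ_C`. [folklore] -/
theorem stateMomentStr_map_cellLift (β : ℝ) {n : ℕ} (q : Fin n → Fin 4 × Fin 4) (x : Fin n → Site 4) :
    stateMomentStr G r (Measure.map Ce.lift (Ce.measure r.ρ β)) n q x =
      ∫ U, ∏ i, (plane G r (q i) (x i) (Ce.lift U) - Ce.mean r.ρ β (fun V => plaquetteObs r.ρ 0 (q i).1 (q i).2 V))
        ∂(Ce.measure r.ρ β) := by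
  unfold stateMomentStr
  have hl : AEMeasurable Ce.lift (Ce.measure (G := G) r.ρ β) := (measurable_cellLift Ce).aemeasurable
  have h1 : ∀ i, ∫ V, plane G r (q i) (x i) V ∂(Measure.map Ce.lift (Ce.measure r.ρ β)) =
      Ce.mean r.ρ β (fun V => plaquetteObs r.ρ 0 (q i).1 (q i).2 V) := fun i => by
    rw [integral_map hl (measurable_plane r (q i) (x i)).aestronglyMeasurable, integral_plane_cellLift_eq]
  simp_rw [h1]
  rw [integral_map hl]
  exact (Finset.measurable_prod _ fun i _ => (measurable_plane r (q i) (x i)).sub measurable_const).aestronglyMeasurable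

/-- ★ **The cell mean of the action density is the sum of the six plane means.** [folklore] -/
theorem mean_curvature_eq_sum_plane (β : ℝ) :
    Ce.mean r.ρ β r.curvature.F =
      ∑ q ∈ Finset.univ.filter (fun q : Fin 4 × Fin 4 => q.1 < q.2),
        Ce.mean r.ρ β (fun V => plaquetteObs r.ρ 0 q.1 q.2 V) := by
  have h0 : Ce.mean r.ρ β r.curvature.F = ∫ U, dens G r 0 (Ce.lift U) ∂(Ce.measure r.ρ β) :=
    (integral_obs_shift_lift_eq_mean Ce r.ρ β r.curvature.F 0).symm
  rw [h0]
  simp_rw [← integral_plane_cellLift_eq Ce r β _ 0]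
  rw [← integral_finsetSum _ (fun q _ => integrable_plane_cellLift Ce r β q 0)]
  exact integral_congr_ae (Eventually.of_forall fun U => dens_eq_sum_filter_plane r 0 _)

/-- **The centred action density (through the cell lift, centred at the cell mean) is the sum of the six centred plane fields.**
[folklore] -/
theorem dens_cellLift_sub_mean_eq_sum (β : ℝ) (x : Site 4) (U : Ce.Config G) :
    dens G r x (Ce.lift U) - Ce.mean r.ρ β r.curvature.F =
      ∑ q ∈ Finset.univ.filter (fun q : Fin 4 × Fin 4 => q.1 < q.2),
        (plane G r q x (Ce.lift U) - Ce.mean r.ρ β (fun V => plaquetteObs r.ρ 0 q.1 q.2 V)) := by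
  rw [Finset.sum_sub_distrib, ← dens_eq_sum_filter_plane, ← mean_curvature_eq_sum_plane]

/-! ## §3 ★ The partial centred density moments as sums of string moments; the collar bound -/

/-- Reindexing a partial product over `S ⊆ Fin n` by `Fin |S|`. [folklore] -/
theorem prod_finset_eq_prod_fin {n : ℕ} (S : Finset (Fin n)) (f : Fin n → ℝ) :
    ∏ i ∈ S, f i = ∏ j : Fin S.card, f ((S.equivFin.symm j : S) : Fin n) := by
  rw [← Finset.prod_coe_sort S f]
  exact (Equiv.prod_comp S.equivFin.symm (fun i : S => f (i : Fin n))).symm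

/-- ★ **Plane-string expansion of the partial centred density moments of the cell**:
`∫ ∏_{i∈S} (d(τ_{xᵢ}Ũ) − m_C) dμ_C = Σ_{q : Fin |S| → planes} stateMomentStr (map lift μ_C) |S| q (x ∘ S.equivFin⁻¹)`. [folklore] -/
theorem partialMoment_eq_sum_stateMomentStr (β : ℝ) {n : ℕ} (S : Finset (Fin n)) (x : Fin n → Site 4) :
    ∫ U, ∏ i ∈ S, (r.curvature.F (configShift (-(x i)) (Ce.lift U)) - Ce.mean r.ρ β r.curvature.F) ∂(Ce.measure r.ρ β) =
      ∑ q ∈ Fintype.piFinset (fun _ : Fin S.card => Finset.univ.filter fun p : Fin 4 × Fin 4 => p.1 < p.2),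
        stateMomentStr G r (Measure.map Ce.lift (Ce.measure r.ρ β)) S.card q
          (fun j => x ((S.equivFin.symm j : S) : Fin n)) := by
  classical
  simp_rw [stateMomentStr_map_cellLift Ce r β]
  rw [← integral_finsetSum _ (fun q _ => integrable_prod_plane_sub_cell Ce r β q _ _)]
  refine integral_congr_ae (Eventually.of_forall fun U => ?_)
  beta_reduce
  rw [prod_finset_eq_prod_fin S]
  have hexp : ∀ j : Fin S.card,
      r.curvature.F (configShift (-(x ((S.equivFin.symm j : S) : Fin n))) (Ce.lift U)) - Ce.mean r.ρ β r.curvature.F =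
        ∑ q ∈ Finset.univ.filter (fun q : Fin 4 × Fin 4 => q.1 < q.2),
          (plane G r q (x ((S.equivFin.symm j : S) : Fin n)) (Ce.lift U) -
            Ce.mean r.ρ β (fun V => plaquetteObs r.ρ 0 q.1 q.2 V)) := fun j =>
    dens_cellLift_sub_mean_eq_sum Ce r β _ U
  simp_rw [hexp]
  rw [Finset.prod_univ_sum]

/-- ★ **Collar bound for the partial centred density moments from a `CoverMomentBounds6`-type ceiling for the strings of this
cell.**  If every valid plane string of `m` points in `box(L/2)`, pairwise separated by `≥ 2R+4` in some coordinate, has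
`|stateMomentStr (map lift μ_C) m q y| ≤ (C₀/R⁴)^m`, then for every `S ⊆ [n]` and `x` with `xᵢ ∈ box(L/2)` (`i ∈ S`) and the same
separation on `S`: `|∫ ∏_{i∈S} (d(τ_{xᵢ}Ũ) − m_C) dμ_C| ≤ (6C₀/R⁴)^|S|`. [folklore] -/
theorem abs_partialMoment_le_of_strings (β : ℝ) {C₀ : ℝ} {R L : ℕ}
    (H : ∀ (m : ℕ) (q : Fin m → Fin 4 × Fin 4) (y : Fin m → Site 4), (∀ j, (q j).1 < (q j).2) →
      (∀ j, y j ∈ box 4 (L / 2)) → (∀ j j' : Fin m, j ≠ j' → ∃ k : Fin 4, (2 * (R : ℤ) + 4) ≤ |y j k - y j' k|) →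
      |stateMomentStr G r (Measure.map Ce.lift (Ce.measure r.ρ β)) m q y| ≤ (C₀ / (R : ℝ) ^ 4) ^ m)
    {n : ℕ} (S : Finset (Fin n)) (x : Fin n → Site 4) (hbox : ∀ i ∈ S, x i ∈ box 4 (L / 2))
    (hsep : ∀ i ∈ S, ∀ i' ∈ S, i ≠ i' → ∃ k : Fin 4, (2 * (R : ℤ) + 4) ≤ |x i k - x i' k|) :
    |∫ U, ∏ i ∈ S, (r.curvature.F (configShift (-(x i)) (Ce.lift U)) - Ce.mean r.ρ β r.curvature.F) ∂(Ce.measure r.ρ β)| ≤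
      (6 * C₀ / (R : ℝ) ^ 4) ^ S.card := by
  classical
  rw [partialMoment_eq_sum_stateMomentStr Ce r β S x]
  set y : Fin S.card → Site 4 := fun j => x ((S.equivFin.symm j : S) : Fin n) with hy
  have hyb : ∀ j, y j ∈ box 4 (L / 2) := fun j => hbox _ (S.equivFin.symm j).2
  have hys : ∀ j j' : Fin S.card, j ≠ j' → ∃ k : Fin 4, (2 * (R : ℤ) + 4) ≤ |y j k - y j' k| := fun j j' hjj' =>
    hsep _ (S.equivFin.symm j).2 _ (S.equivFin.symm j').2 fun h =>
      hjj' (S.equivFin.symm.injective (Subtype.ext h))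
  refine (Finset.abs_sum_le_sum_abs _ _).trans ?_
  calc ∑ q ∈ Fintype.piFinset (fun _ : Fin S.card => Finset.univ.filter fun p : Fin 4 × Fin 4 => p.1 < p.2),
        |stateMomentStr G r (Measure.map Ce.lift (Ce.measure r.ρ β)) S.card q y|
      ≤ ∑ _q ∈ Fintype.piFinset (fun _ : Fin S.card => Finset.univ.filter fun p : Fin 4 × Fin 4 => p.1 < p.2),
          (C₀ / (R : ℝ) ^ 4) ^ S.card := Finset.sum_le_sum fun q hq => H _ q y (fun j => by
            have h := Fintype.mem_piFinset.1 hq j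
            exact (Finset.mem_filter.1 h).2) hyb hys
    _ = (6 * C₀ / (R : ℝ) ^ 4) ^ S.card := by
        rw [Finset.sum_const, Fintype.card_piFinset, Finset.prod_const, Finset.card_univ, Fintype.card_fin, card_planes,
          nsmul_eq_mul, Nat.cast_pow, Nat.cast_ofNat, ← mul_pow, mul_div_assoc]

/-! ## §4 The sup bound -/

/-- The cell mean of an observable bounded by `B` is bounded by `B`. [folklore] -/
theorem abs_cellMean_le (β : ℝ) {O : LGConfig 4 G → ℝ} {B : ℝ} (hB : ∀ V, |O V| ≤ B) : |Ce.mean r.ρ β O| ≤ B := by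
  haveI := Ce.isProbabilityMeasure_measure (G := G) r.ρ r.continuous β
  have h := norm_integral_le_of_norm_le_const (μ := Ce.measure (G := G) r.ρ β) (f := fun U => O (Ce.lift U)) (C := B)
    (ae_of_all _ fun U => by rw [Real.norm_eq_abs]; exact hB _)
  rwa [Real.norm_eq_abs, probReal_univ, mul_one] at h

/-- ★ **Sup bound for the partial centred density moments**: `|∫ ∏_{i∈S} (d(τ_{xᵢ}Ũ) − m_C) dμ_C| ≤ (2B)^|S|` for `|d| ≤ B`.
[folklore] -/
theorem abs_partialMoment_le_pow (β : ℝ) {B : ℝ} (hB : ∀ V, |r.curvature.F V| ≤ B) {n : ℕ} (S : Finset (Fin n))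
    (x : Fin n → Site 4) :
    |∫ U, ∏ i ∈ S, (r.curvature.F (configShift (-(x i)) (Ce.lift U)) - Ce.mean r.ρ β r.curvature.F) ∂(Ce.measure r.ρ β)| ≤
      (2 * B) ^ S.card := by
  haveI := Ce.isProbabilityMeasure_measure (G := G) r.ρ r.continuous β
  have hm : |Ce.mean r.ρ β r.curvature.F| ≤ B := abs_cellMean_le Ce r β hB
  have hpt : ∀ U : Ce.Config G,
      |∏ i ∈ S, (r.curvature.F (configShift (-(x i)) (Ce.lift U)) - Ce.mean r.ρ β r.curvature.F)| ≤ (2 * B) ^ S.card := by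
    intro U
    rw [Finset.abs_prod]
    calc ∏ i ∈ S, |r.curvature.F (configShift (-(x i)) (Ce.lift U)) - Ce.mean r.ρ β r.curvature.F|
        ≤ ∏ _i ∈ S, (2 * B) := Finset.prod_le_prod (fun _ _ => abs_nonneg _) fun i _ =>
          (abs_sub _ _).trans (by linarith [hB (configShift (-(x i)) (Ce.lift U)), hm])
      _ = (2 * B) ^ S.card := Finset.prod_const _
  have h := norm_integral_le_of_norm_le_const (μ := Ce.measure (G := G) r.ρ β)
    (f := fun U => ∏ i ∈ S, (r.curvature.F (configShift (-(x i)) (Ce.lift U)) - Ce.mean r.ρ β r.curvature.F))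
    (C := (2 * B) ^ S.card) (ae_of_all _ fun U => by rw [Real.norm_eq_abs]; exact hpt U)
  rwa [Real.norm_eq_abs, probReal_univ, mul_one] at h

end Summit.QuantumFields.YangMills.Theorems.RecentredCoverTransfer

end
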